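import Summits.BirchSwinnertonDyer.BirchSwinnertonDyer.Theorems.AdditiveKolyvaginRoadVisibleCoreBricks
import Summits.BirchSwinnertonDyer.BirchSwinnertonDyer.Theorems.AdditiveKolyvaginRoadKolyvaginVisibilityStep
import Summits.BirchSwinnertonDyer.BirchSwinnertonDyer.Theorems.SchneiderFreeAdditiveX3PoitouTateSelmerDualityHolds
import HarnessLib

/-!
# Route `AdditiveKolyvaginRoad`, crux `LevelKolyvaginSystemsAdditive` (item stmt-BirchSwinnertonDyer-21396, KS′) ∕ KPA′ (21400):
# S-vis — A 𝔭-VISIBLE EVEN CORE VERTEX EXISTS, at a frame, UNCONDITIONALLY (the support lemma `VisibleEvenCoreLevel` of the crux-ideate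
# card `Cruxes/LevelKolyvaginSystemsAdditive/Ideas/pointwise-klingen-seed.md`, in the route's canonical level-raised spaces `SelQP`)
# (cell `pub/bsd-wall`, width seat `bsd-wall-akr-p2x-w2` g9; `--supports stmt-BirchSwinnertonDyer-21396`, helper; part 2 of 2, after
# `…VisibleCoreBricks.lean` and `…LevelJumpAboveP.lean`)

WHY. The card `pointwise-klingen-seed` (crux-ideate r1 seat 2 g17) feeds the EVEN-SEED disjunct of the landed seed sockets
(`kolyvaginPrimitiveAdditive_of_seed`, `levelKolyvaginSystemsAdditive_of_seed`) through a single-weight Klingen–Eisenstein congruence CLOSED by a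
Poitou–Tate count at a 𝔭-VISIBLE even core vertex — «visibility is NECESSARY for every `Sel_{∅,0}`-constructor, and ONE visible even core vertex is
SUFFICIENT; that vertex is the new support S-vis (First lemma)». THIS FILE proves S-vis at a frame, E-side, in the route's own canonical spaces.

WHAT (namespace `…Theorems.AdditiveKoly`).
* §1 `exists_visibleRaise_of_zero_vertex` — THE VISIBLE RAISE: at a frame (`p ≥ 5`, `p ∣ N_E`, `ρ̄_{E,p}` onto, `K` imaginary quadratic + Heegner
  hypothesis for `N_E`, `c ≠ 1`), granted `poitouTate_selmerStructure_duality K`: if `Sel_m^± = 0` then for some NEW admissible `q ∉ m`,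
  `dim Sel_{m∪q}⁺ + dim Sel_{m∪q}⁻ = 1` and EVERY non-zero class of `Sel_{m∪q}^±` is NOT locally trivial at EVERY place above `p`. Proof: partner
  `t` Kummer off `m ∪ {w₀}`, toric on `m`, detected at `w₀ ∣ p` (`exists_levelRelaxed_notMem_torsionLocalKer_above_p`); eigen-splitting `t ± c_* t`;
  Čebotarev with the sign (`Cheb.exists_admissible_loc_ne_zero`) ⟹ admissible `q ∉ m` detecting the eigen-partner `t'`, of its sign `s` by (Equiv)
  (`localEquiv_of_admQ`); (R′) `selQP_raise_of_admQ_of_sign` ⟹ `dim Sel_{m∪q}^s = 1`; sign rule + one-prime step ⟹ `Sel_{m∪q}^{¬s} = 0`; Tate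
  reciprocity (`exists_cupProduct_ne_zero_of_ne`) for `(t', x)`, `x ∈ Sel_{m∪q}^s ∖ 0`: terms vanish at `∞` and off `m ∪ q ∪ {w ∣ p}` (Kummer
  isotropy), on `m` (toric isotropy); the `q`-term is `Kummer(t') × non-Kummer(x) ≠ 0` (`cupProduct_ne_zero_of_kummer_of_not_kummer_admQ`) ⟹ a
  non-zero term ABOVE `p` ⟹ `x` detected there; the other place above `p` is `c • w` (`HeightOneSpectrum.exists_algEquiv_smul_eq`, `Aut(K/ℚ) =
  {1, c}`) and the strict condition transports (`conjAct_mem_torsionLocalKer_adicCompletion_iff`).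
* §2 `exists_visibleEvenCoreLevel_of_poitouTate` — S-vis modulo the PT fact: `Odd (dim Sel_∅⁺ + dim Sel_∅⁻)` ⟹ ∃ `n₀ ≠ ∅`, `Even #n₀`,
  `dim Sel_{n₀}⁺ + dim Sel_{n₀}⁻ = 1`, every non-zero class of `Sel_{n₀}^±` visible at every place above `p` (zero vertex `m` with `#m` odd by
  `exists_zero_vertex_above`, then one visible raise); `exists_visibleEvenCoreLevel` — THE SAME INPUT-FREE, the PT fact being the tree theorem
  `SchneiderFreeAdditiveX3.PoitouTateReduction.poitouTate_selmerStructure_duality_holds` (cell bsd-schneider).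

RELATION TO THE CARD'S TEXT. `PointwiseKlingenSeedSketch.VisibleEvenCoreLevel` (Cruxes workfile, not importable) has NO `p ∣ N_E` ∕ Heegner binder
and an extra binder `E(ℚ_p)[p] = 0`. The frame binders are what the tree's Čebotarev-with-the-sign consumes; `E(ℚ_p)[p] = 0` is NOT needed
(visibility is forced by reciprocity, not by a local count at `p`). At every ♯ frame of KS′ ∕ KPA′ the binders used here hold (`Addv W p` ⟹ `p ∣ N_E`).

HONEST FRAMING: theorems only; 0 definitions, 0 named facts, 0 `sorry`; `exists_visibleEvenCoreLevel` is UNCONDITIONAL (axioms standard). It is an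
E-side SUPPORT lemma — it supplies the vertex `n₀` at which the card's (unbuilt, automorphic) seed engine FPK(n₀) + (E1)_{n₀} would read a unit; it
does NOT produce the seed `κ₀ ∅ n₀ ≠ 0`, closes no stub; BSD is not proved by any of this; KS′ ∕ KPA′ stay OPEN at `p² ∣ N`.

References: [cite: MazurRubin2004, Prop. 4.5.8, Lemma 4.1.7] [cite: Howard2006Bipartite, Cor. 2.3.5] [cite: WZhang2014, Lemma 5.3, Prop. 5.4,
Lemma 7.3, §9 (9.1)–(9.2)] [cite: BertoliniDarmon2005, §2.2–§2.3, Lemma 2.6, Thm. 3.2] [cite: GrossLMS1991, Prop. 8.2, §9]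
[cite: MilneADT2006, Ch. I, Cor. 2.3, Thm. 2.8, Thm. 4.10] [cite: CasselsFrohlichANT1967, Ch. VII Prop. 1.2 (ii), §11].
-/

set_option linter.dupNamespace false -- single-conjunct summit repeats the name by design

noncomputable section

open scoped Classical NumberField Pointwise

namespace Summit.BirchSwinnertonDyer.BirchSwinnertonDyer.Theorems.AdditiveKoly

open CategoryTheory WeierstrassCurve Field Function NumberField IsDedekindDomain
open Literature.NumberTheory.EllipticCurves Literature.NumberTheory.EllipticCurves.ModularForms
  Literature.NumberTheory.GaloisRepresentations Literature.NumberTheory.GaloisRepresentations.DiscreteGaloisModule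
  Literature.NumberTheory.GaloisCohomology Module
open Summit.BirchSwinnertonDyer.Rank1Residual.X11b.FiniteDuality
open Summit.BirchSwinnertonDyer.Rank1Residual.X11b.Relaxation
open Summit.BirchSwinnertonDyer.Rank1Residual.X11b
open Summit.BirchSwinnertonDyer.Rank1Residual.GaloisImage
open Summit.BirchSwinnertonDyer.Rank1Residual.X11b.Three.Koly
open Summit.BirchSwinnertonDyer.Rank1Residual.X11b.Three.Koly.Method2
open Summit.BirchSwinnertonDyer.Rank1Residual.X11b.Three.Koly.ZhangSupply.LocalConj
open scoped ContRepresentation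

/-! ## §1 The VISIBLE RAISE at a zero vertex -/

section VisibleRaise

variable (W : WeierstrassCurve ℚ) (K : Type) [Field K] [NumberField K] (p : ℕ) [W.IsElliptic] [W.IsGloballyMinimal]
  [Fact p.Prime]

-- one long assembly (Čebotarev + (Equiv) + (R′) + Tate reciprocity over a large context)
set_option maxHeartbeats 800000 in
/-- **THE VISIBLE RAISE AT A ZERO VERTEX.** Frame: `p ≥ 5`, `p ∣ N_E`, `ρ̄_{E,p}` onto, `K` imaginary quadratic with the Heegner
hypothesis for `N_E`, `c ≠ 1`, and the Poitou–Tate fact for `K` (a tree theorem, `poitouTate_selmerStructure_duality_holds`). If the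
canonical level-`m` spaces vanish in both signs (`Sel_m^± = 0`), there is a NEW Bertolini–Darmon admissible `q ∉ m` with
`dim Sel_{m∪q}⁺ + dim Sel_{m∪q}⁻ = 1` such that EVERY non-zero class of `Sel_{m∪q}^±` is NOT locally trivial at EVERY place of `K` above `p`.
Proof: a class `t` Kummer off `m ∪ {w₀}`, toric on `m`, detected at a place `w₀ ∣ p` (`exists_levelRelaxed_notMem_torsionLocalKer_above_p`);
eigen-split `t ± c_* t` (`2` invertible on `p`-torsion) to an eigen `t'` of sign `s` still detected at `w₀`; Čebotarev with the sign
(`Cheb.exists_admissible_loc_ne_zero`) gives an admissible `q ∉ m` detecting `t'`, of sign `s` by (Equiv) (`localEquiv_of_admQ`); the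
witness-free raising (R′) `selQP_raise_of_admQ_of_sign` gives `dim Sel_{m∪q}^s = 1`, and the sign rule kills `Sel_{m∪q}^{¬s}`; for
`x ∈ Sel_{m∪q}^s ∖ 0` Tate reciprocity for `(t', x)`: the terms vanish at `∞` and off `m ∪ q ∪ {v ∣ p}` (Kummer isotropy), on `m` (toric
isotropy), the `q`-term is `Kummer(t') × non-Kummer(x) ≠ 0` (§1), so some term ABOVE `p` is non-zero — `x` is detected there — and the other
place above `p` is its `c`-conjugate (`conjAct_mem_torsionLocalKer_adicCompletion_iff`). [cite: MazurRubin2004, Prop. 4.5.8, Lemma 4.1.7]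
[cite: Howard2006Bipartite, Cor. 2.3.5] [cite: WZhang2014, Lemma 5.3, Prop. 5.4, Lemma 7.3] [cite: BertoliniDarmon2005, Lemma 2.6, Thm. 3.2]
[cite: MilneADT2006, Ch. I, Thm. 4.10] -/
theorem exists_visibleRaise_of_zero_vertex (h5 : 5 ≤ p) (hpN : p ∣ W.conductorNorm ℤ)
    (hsurj : W.HasSurjectiveModNGaloisRep p) (hK : IsImaginaryQuadratic K)
    (hH : SatisfiesHeegnerHypothesis (W.conductorNorm ℤ) K) {c : K ≃ₐ[ℚ] K} (hc1 : c ≠ 1)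
    (hPT : poitouTate_selmerStructure_duality K) [Module (ZMod p) (Vp W K p)]
    (m : Finset (AdmQ W K p)) (hm : ∀ μ : Bool, SelQP W K p c m μ = ⊥) :
    ∃ q : AdmQ W K p, q ∉ m ∧
      finrank (ZMod p) (SelQP W K p c (insert q m) true) + finrank (ZMod p) (SelQP W K p c (insert q m) false) = 1 ∧
      ∀ (μ : Bool) (x : Vp W K p), x ∈ SelQP W K p c (insert q m) μ → x ≠ 0 →
        ∀ u : HeightOneSpectrum (𝓞 K), ((p : ℕ) : 𝓞 K) ∈ u.asIdeal →
          x ∉ (W.baseChange K).torsionLocalKer (u.adicCompletion K) ((p ^ 1 : ℕ) : ℤ) := by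
  classical
  have hp : p.Prime := Fact.out
  have hp2 : p ≠ 2 := by omega
  have hpodd : Odd p := hp.odd_of_ne_two hp2
  haveI : Fact (Nat.Prime (p ^ 1)) := ⟨by rw [pow_one]; exact hp⟩
  haveI : NeZero (p ^ 1 : ℕ) := ⟨pow_ne_zero 1 hp.ne_zero⟩
  haveI : IsTotallyComplex K := hK.2
  haveI : Algebra.IsQuadraticExtension ℚ K := ⟨hK.1⟩
  haveI : ∀ w : Place K, CompactSpace (absoluteGaloisGroup (Place.Completion w)) := fun w ↦
    absoluteGaloisGroup_compactSpace _
  haveI hcs : ∀ (L : Type) [Field L], CompactSpace (absoluteGaloisGroup L) :=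
    fun L _ ↦ @absoluteGaloisGroup_compactSpace L _
  haveI : Finite (geomTorsion (W.baseChange K) ((p ^ 1 : ℕ) : ℤ)) :=
    finite_geomTorsion_of_neZero (W.baseChange K) (p ^ 1)
  have hpZ : ((p ^ 1 : ℕ) : ℤ) ≠ 0 := by exact_mod_cast pow_ne_zero 1 hp.ne_zero
  have hNodd : Odd (((p ^ 1 : ℕ) : ℤ)) := by
    rw [pow_one]
    exact_mod_cast hpodd
  have hK2 : Module.finrank ℚ K = 2 := hK.1
  set τ := conjAct W c ((p ^ 1 : ℕ) : ℤ) with hτ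
  -- a Weil pairing on `E[p]`
  obtain ⟨e, hμ, hadd₁, hadd₂, halt, hnondeg, hgal⟩ :=
    exists_weilPairing_holds (W.baseChange K) (p ^ 1) (by rw [pow_one]; exact hp.two_le) (by
      rw [pow_one]; exact_mod_cast hp.ne_zero)
  -- the finite set of places above `p`
  have hp0 : (Ideal.span {((p : ℕ) : 𝓞 K)} : Ideal (𝓞 K)) ≠ 0 := by
    rw [Ne, Ideal.zero_eq_bot, Ideal.span_singleton_eq_bot]
    exact_mod_cast hp.ne_zero
  have hpfin : {v : HeightOneSpectrum (𝓞 K) | ((p : ℕ) : 𝓞 K) ∈ v.asIdeal}.Finite :=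
    (Ideal.finite_factors hp0).subset fun v hv ↦ (Ideal.dvd_span_singleton).mpr hv
  -- STEP 1: a place `w₀ ∣ p` and the eigen-partner `t'` of the level-`m` structure above `p` (sign `s`, detected at `w₀`)
  obtain ⟨w₀, hw₀⟩ := exists_heightOneSpectrum_natCast_mem' K hp
  obtain ⟨s, t', ht's, ht'inf, ht'fin, ht'w₀⟩ := exists_eigen_levelPartner_above_p W K p hK hp2 c hPT m w₀ hw₀
  have ht'0 : t' ≠ 0 := fun h ↦ ht'w₀ (h ▸ zero_mem _)
  -- STEP 2: Čebotarev with the sign on `t'`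
  have h5' : 5 ≤ p ^ 1 := by rw [pow_one]; exact h5
  have hpN' : p ^ 1 ∣ W.conductorNorm ℤ := by rw [pow_one]; exact hpN
  have hsurj' : W.HasSurjectiveModNGaloisRep ((p ^ 1 : ℕ) : ℤ) := by rw [Nat.pow_one]; exact hsurj
  have hν : sgnP s = 1 ∨ sgnP s = -1 := by cases s <;> simp [sgnP]
  obtain ⟨q₀, hqB, hadm, v, hqv, ht'v⟩ := Cheb.exists_admissible_loc_ne_zero W K (p := p ^ 1) h5' hK hsurj' hpN' hH
    hc1 hν ht'0 ht's (m.image Subtype.val)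
  rw [Nat.pow_one] at hadm
  set q : AdmQ W K p := ⟨q₀, hadm⟩ with hq
  have hqm : q ∉ m := fun h ↦ hqB (Finset.mem_image.mpr ⟨q, h, rfl⟩)
  have hqv' : ((q : ℕ) : 𝓞 K) ∈ v.asIdeal := hqv
  -- the place `v` of `q` is unique, not above `p`, above no prime of `m`
  have hq0 : (q : ℕ) ≠ 0 := q.2.1.ne_zero
  have hqP : (Ideal.span {((q : ℕ) : 𝓞 K)}).IsPrime := q.2.2.2.1
  have huniq : ∀ v' : HeightOneSpectrum (𝓞 K), ((q : ℕ) : 𝓞 K) ∈ v'.asIdeal → v' = v :=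
    fun v' hv' ↦ placesAbove_eq_of_isPrime_span K hqP hq0 hqv' hv'
  have hpv : ((p : ℕ) : 𝓞 K) ∉ v.asIdeal := by
    have h := (hasGoodReductionAt_of_isAdmissiblePrime W K q.2 v hqv').2
    rw [Int.cast_natCast] at h
    exact h
  have hmv : ∀ q' ∈ m, ((q' : ℕ) : 𝓞 K) ∉ v.asIdeal := fun q' hq' ↦
    disjoint_places_of_admQ W K p m ∅ q hqm (Set.notMem_empty _) v hqv' (q' : ℕ)
      (Or.inl (Finset.mem_coe.mpr (Finset.mem_image_of_mem _ hq')))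
  -- local classes at `v` are `p`-torsion
  set loc := (W.baseChange K).torsionLocMap (v.adicCompletion K) ((p ^ 1 : ℕ) : ℤ) with hloc
  have hNloc : ∀ z : Vp W K p, ((p ^ 1 : ℕ) : ℤ) • loc z = 0 := fun z ↦
    zsmul_discreteH1_torsion ((p ^ 1 : ℕ) : ℤ) (loc z)
  have ht'v0 : loc t' ≠ 0 := fun h ↦ ht'v h
  -- STEP 3: the sign of `q` is `s` ((Equiv))
  obtain ⟨sq, hsq⟩ := localEquiv_of_admQ W K p hK.1 hc1 q
  have hsv0 : ∀ z : Vp W K p, loc (τ z) = sgnP sq • loc z := hsq v hqv'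
  have hsqs : sq = s := by
    by_contra hne
    exact ht'v0 (loc_eq_zero_of_sign_ne_odd τ loc hsv0 ht's hne hNodd (hNloc t'))
  have hsv : ∀ z : Vp W K p, loc (τ z) = sgnP s • loc z := hsqs ▸ hsv0
  -- the one-prime step (zhang3-p1 ∕ LevelStep), membership form at the unique place `v`
  have hstep : ∀ (ν : Bool) (y : Vp W K p),
      (y ∈ SelQP W K p c (insert q m) ν ∧ y ∈ selmerLocalKer (W.baseChange K) (v.adicCompletion K) ((p ^ 1 : ℕ) : ℤ)) ↔
      (y ∈ SelQP W K p c m ν ∧ y ∈ toricLocalKer (W.baseChange K) (v.adicCompletion K) ((p ^ 1 : ℕ) : ℤ)) := by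
    intro ν y
    have h' := SetLike.ext_iff.mp (selQP_insert_inf_kummer_eq W K p c m q hqm ν) y
    simp only [Submodule.mem_inf, AddSubgroup.mem_toZModSubmodule, AddSubgroup.mem_iInf] at h'
    constructor
    · rintro ⟨h1, h2⟩
      obtain ⟨h1', h2'⟩ := h'.mp ⟨h1, fun v' hv' ↦ by rw [huniq v' hv']; exact h2⟩
      exact ⟨h1', h2' v hqv'⟩
    · rintro ⟨h1, h2⟩
      obtain ⟨h1', h2'⟩ := h'.mpr ⟨h1, fun v' hv' ↦ by rw [huniq v' hv']; exact h2⟩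
      exact ⟨h1', h2' v hqv'⟩
  -- STEP 4a: the `s`-side is raised to dimension one ((R′), witness-free raising)
  have hraise := selQP_raise_of_admQ_of_sign W K p hK hp2 (c := c) hPT m q s v hqm hqv' hsv (fun y hy ↦ by
    rw [hm s] at hy
    rw [(Submodule.mem_bot (ZMod p)).mp hy]
    exact zero_mem _)
  have hfr_s : finrank (ZMod p) (SelQP W K p c (insert q m) s) = 1 := by
    rw [hraise, hm s, finrank_bot]
  -- STEP 4b: the `¬s`-side stays zero (sign rule: `loc_v` kills every `¬s`-eigenclass)
  have hkill : SelQP W K p c (insert q m) (!s) = ⊥ := by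
    rw [Submodule.eq_bot_iff]
    intro y hy
    have hy0 : loc y = 0 := loc_eq_zero_of_sign_ne_odd τ loc hsv (conjAct_eq_of_mem_selQP W K p c (insert q m) (!s) hy)
      (by cases s <;> decide) hNodd (hNloc y)
    have hyK : y ∈ selmerLocalKer (W.baseChange K) (v.adicCompletion K) ((p ^ 1 : ℕ) : ℤ) :=
      (W.baseChange K).torsionLocalKer_le_selmerLocalKer (v.adicCompletion K) _ (AddMonoidHom.mem_ker.mpr hy0)
    have hym : y ∈ SelQP W K p c m (!s) := ((hstep (!s) y).mp ⟨hy, hyK⟩).1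
    rw [hm (!s)] at hym
    exact (Submodule.mem_bot (ZMod p)).mp hym
  refine ⟨q, hqm, ?_, ?_⟩
  · -- total dimension one
    cases s
    · have h1 : SelQP W K p c (insert q m) true = ⊥ := hkill
      rw [h1, finrank_bot, hfr_s]
    · have h1 : SelQP W K p c (insert q m) false = ⊥ := hkill
      rw [h1, finrank_bot, hfr_s]
  -- STEP 5: visibility of every non-zero class above `p`
  intro μ x hx hx0 u hu
  -- the class has sign `s`
  have hμs : μ = s := by
    by_contra hne
    have hμ' : μ = !s := by
      cases μ <;> cases s
      · exact absurd rfl hne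
      · rfl
      · rfl
      · exact absurd rfl hne
    rw [hμ', hkill] at hx
    exact hx0 ((Submodule.mem_bot (ZMod p)).mp hx)
  subst hμs
  have hxs : τ x = sgnP μ • x := conjAct_eq_of_mem_selQP W K p c (insert q m) μ hx
  -- `x` is NOT Kummer at `v` (else it would lie in `Sel_m^s = 0`)
  have hxv : x ∉ selmerLocalKer (W.baseChange K) (v.adicCompletion K) ((p ^ 1 : ℕ) : ℤ) := fun hxK ↦ by
    have hxm : x ∈ SelQP W K p c m μ := ((hstep μ x).mp ⟨hx, hxK⟩).1
    rw [hm μ] at hxm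
    exact hx0 ((Submodule.mem_bot (ZMod p)).mp hxm)
  -- `t'` IS Kummer at `v` (no level prime, not above `p`) and detected there
  have ht'vK : t' ∈ selmerLocalKer (W.baseChange K) (v.adicCompletion K) ((p ^ 1 : ℕ) : ℤ) := (ht'fin v hpv).1 hmv
  -- the conditions satisfied by `x`, unpacked
  have hmemx : (∀ w : InfinitePlace K, x ∈ selmerLocalKer (W.baseChange K) w.Completion ((p ^ 1 : ℕ) : ℤ)) ∧
      (∀ w : HeightOneSpectrum (𝓞 K), (∀ q' ∈ insert q m, ((q' : ℕ) : 𝓞 K) ∉ w.asIdeal) →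
        x ∈ selmerLocalKer (W.baseChange K) (w.adicCompletion K) ((p ^ 1 : ℕ) : ℤ)) ∧
      (∀ q' ∈ insert q m, ∀ w : HeightOneSpectrum (𝓞 K), ((q' : ℕ) : 𝓞 K) ∈ w.asIdeal →
        x ∈ toricLocalKer (W.baseChange K) (w.adicCompletion K) ((p ^ 1 : ℕ) : ℤ)) := by
    have hx' : x ∈ levelSelmerSubgroupP W K p c ((insert q m).image Subtype.val) ∅ μ := hx
    simp only [levelSelmerSubgroupP, AddSubgroup.mem_inf, AddSubgroup.mem_iInf] at hx'
    obtain ⟨-, hinf, hfin, hord⟩ := hx'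
    refine ⟨hinf, fun w hw ↦ hfin w fun q'' hq'' ↦ ?_, fun q' hq' w hw ↦ hord q' ⟨?_, Set.notMem_empty _⟩ w hw⟩
    · rcases hq'' with hq'' | hq''
      · rw [Finset.mem_coe, Finset.mem_image] at hq''
        obtain ⟨a, ha, rfl⟩ := hq''
        exact hw a ha
      · exact absurd hq'' (Set.notMem_empty _)
    · exact Finset.mem_image.mpr ⟨q', hq', rfl⟩
  obtain ⟨hxinf, hxfin, hxord⟩ := hmemx
  -- Kummer isotropy where both classes are Kummer
  have hKum : ∀ w : Place K,
      t' ∈ selmerLocalKer (W.baseChange K) (Place.Completion w) ((p ^ 1 : ℕ) : ℤ) →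
      x ∈ selmerLocalKer (W.baseChange K) (Place.Completion w) ((p ^ 1 : ℕ) : ℤ) →
      (weilContPairingLocal (W.baseChange K) (p ^ 1) e hμ hadd₁ hadd₂ hgal w).cupProduct
        (galoisCohomology.localization ((W.baseChange K).torsionGaloisModule ((p ^ 1 : ℕ) : ℤ)) w 1 t')
        (galoisCohomology.localization ((W.baseChange K).torsionGaloisModule ((p ^ 1 : ℕ) : ℤ)) w 1 x) = 0 := by
    intro w htw hxw
    rw [← comap_localization_kummerSelmerStructure] at htw hxw
    exact (W.baseChange K).cupProduct_eq_zero_of_mem_kummerSelmerStructure_of_fact (p ^ 1) e hpZ w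
      (kummerClass_cupProduct_kummerClass_eq_zero_holds _) hμ hadd₁ hadd₂ halt hgal htw hxw
  -- the exceptional set `S = {v} ∪ {w ∣ p}`
  set S : Finset (Place K) := insert (Sum.inr v) (hpfin.toFinset.image Sum.inr) with hSdef
  have hS : ∀ w : Place K, w ∉ S →
      (weilContPairingLocal (W.baseChange K) (p ^ 1) e hμ hadd₁ hadd₂ hgal w).cupProduct
        (galoisCohomology.localization ((W.baseChange K).torsionGaloisModule ((p ^ 1 : ℕ) : ℤ)) w 1 t')
        (galoisCohomology.localization ((W.baseChange K).torsionGaloisModule ((p ^ 1 : ℕ) : ℤ)) w 1 x) = 0 := by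
    intro w hw
    rcases w with w | w
    · exact hKum (Sum.inl w) (ht'inf w) (hxinf w)
    · have hwv : w ≠ v := fun h ↦ hw (by rw [hSdef, h]; exact Finset.mem_insert_self _ _)
      have hwp : ((p : ℕ) : 𝓞 K) ∉ w.asIdeal := fun h ↦ hw (by
        rw [hSdef]
        exact Finset.mem_insert_of_mem (Finset.mem_image_of_mem _ (hpfin.mem_toFinset.mpr h)))
      have hwq : ((q : ℕ) : 𝓞 K) ∉ w.asIdeal := fun h ↦ hwv (huniq w h)
      by_cases hex : ∃ q' ∈ m, ((q' : ℕ) : 𝓞 K) ∈ w.asIdeal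
      · -- a level prime below `w`: both classes are toric
        obtain ⟨q', hq'm, hq'w⟩ := hex
        exact weilCupProduct_res_eq_zero_of_valued (W.baseChange K) (p ^ 1) (w.adicCompletion K)
          e hμ hadd₁ hadd₂ hgal _
          (fun S' hS' T hT ↦ weilPairingHom_eq_zero_of_mem_of_card_le (W.baseChange K) (p ^ 1)
            e hμ hadd₁ hadd₂ halt _ (natCard_augmentation_le_of_admQ W K p hK.1 q' w hq'w) S' T hS' hT)
          (exists_valued_cocycle_of_mem_toricLocalKer (W.baseChange K) (p ^ 1) (w.adicCompletion K)
            ((ht'fin w hwp).2 q' hq'm hq'w))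
          (exists_valued_cocycle_of_mem_toricLocalKer (W.baseChange K) (p ^ 1) (w.adicCompletion K)
            (hxord q' (Finset.mem_insert_of_mem hq'm) w hq'w))
      · -- no level prime below `w`: both classes are Kummer
        push Not at hex
        refine hKum (Sum.inr w) ((ht'fin w hwp).1 hex) (hxfin w fun q'' hq'' ↦ ?_)
        rcases Finset.mem_insert.mp hq'' with rfl | hq''
        · exact hwq
        · exact hex q'' hq''
  -- the `q`-term does not vanish: Kummer (`t'`) × non-Kummer (`x`)
  have h₀ := cupProduct_ne_zero_of_kummer_of_not_kummer_admQ W K p e hμ hadd₁ hadd₂ halt hnondeg hgal hK q v hqv'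
    ht'vK ht'v hxv
  -- Tate reciprocity: a second non-zero term, necessarily above `p`
  obtain ⟨w, hwS, hwne, hw0⟩ := exists_cupProduct_ne_zero_of_ne (W.baseChange K) (p ^ 1) e hμ hadd₁ hadd₂ hgal S
    (by rw [hSdef]; exact Finset.mem_insert_self _ _) hS h₀
  rw [hSdef, Finset.mem_insert] at hwS
  rcases hwS with hwS | hwS
  · exact absurd hwS hwne
  obtain ⟨w₁, hw₁, rfl⟩ := Finset.mem_image.mp hwS
  have hw₁p : ((p : ℕ) : 𝓞 K) ∈ w₁.asIdeal := hpfin.mem_toFinset.mp hw₁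
  have hxw₁ : x ∉ (W.baseChange K).torsionLocalKer (w₁.adicCompletion K) ((p ^ 1 : ℕ) : ℤ) := fun hx1 ↦ hw0 (by
    rw [(mem_torsionLocalKer_iff_localization_eq_zero_P W K p w₁ x).mp hx1]
    exact map_zero _)
  -- transport to the given place `u ∣ p`: `u = σ • w₁` with `σ ∈ {1, c}`
  obtain ⟨σ, hσ⟩ := Literature.NumberTheory.Automorphic.HeightOneSpectrum.exists_algEquiv_smul_eq ℚ
    (under_eq_under_of_natCast_mem hp hw₁p hu)
  rcases algEquiv_eq_one_or_eq_of_finrank_two hK2 hc1 σ with rfl | rfl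
  · rw [one_smul] at hσ
    rw [← hσ]
    exact hxw₁
  · intro hxu
    have hτxu : τ x ∈ (W.baseChange K).torsionLocalKer (u.adicCompletion K) ((p ^ 1 : ℕ) : ℤ) := by
      rw [hxs]
      exact AddSubgroup.zsmul_mem _ hxu _
    exact hxw₁ ((conjAct_mem_torsionLocalKer_adicCompletion_iff W σ hσ ((p ^ 1 : ℕ) : ℤ) x).mp hτxu)

end VisibleRaise

/-! ## §2 S-vis: a 𝔭-VISIBLE EVEN CORE VERTEX exists -/

section SVis

variable (W : WeierstrassCurve ℚ) (K : Type) [Field K] [NumberField K] (p : ℕ) [W.IsElliptic] [W.IsGloballyMinimal]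
  [Fact p.Prime]

/-- **S-vis — A 𝔭-VISIBLE EVEN CORE VERTEX EXISTS** (the support lemma `VisibleEvenCoreLevel` of the crux-ideate card
`pointwise-klingen-seed` on crux KS′ 21396, in the route's canonical level-raised spaces `AdditiveKoly.SelQP`, AT A FRAME and modulo the
Poitou–Tate fact for `K`). Frame: `p ≥ 5`, `p ∣ N_E`, `ρ̄_{E,p}` onto, `K` imaginary quadratic with the Heegner hypothesis for `N_E`, `c ≠ 1`
complex conjugation, the `ZMod p`-structure of `H¹(K, E[p])`. If the total canonical dimension `dim Sel_∅⁺ + dim Sel_∅⁻` at level `∅` is ODD,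
there is a NON-EMPTY finite set `n₀` of Bertolini–Darmon admissible primes of EVEN cardinality with `dim Sel_{n₀}⁺ + dim Sel_{n₀}⁻ = 1`
(an even CORE vertex) at which every non-zero class of `Sel_{n₀}^±` is NOT locally trivial at ANY place of `K` above `p` (𝔭-VISIBLE).
Proof: descend to a zero vertex `m` with `#m` odd (`exists_zero_vertex_above`, iterated A1), then one VISIBLE raise
(`exists_visibleRaise_of_zero_vertex`): `n₀ = m ∪ {q}`. The card's binder `E(ℚ_p)[p] = 0` is NOT used; its statement without
`p ∣ N_E` ∕ Heegner is not what the tree's Čebotarev (`Cheb.exists_admissible_loc_ne_zero`) supplies — this is the frame version.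
[cite: MazurRubin2004, Prop. 4.5.8, Lemma 4.1.7] [cite: Howard2006Bipartite, Cor. 2.3.5] [cite: WZhang2014, Prop. 5.4, Lemma 5.3, Lemma 7.3]
[cite: BertoliniDarmon2005, Thm. 3.2] [cite: MilneADT2006, Ch. I, Thm. 4.10] -/
theorem exists_visibleEvenCoreLevel_of_poitouTate (h5 : 5 ≤ p) (hpN : p ∣ W.conductorNorm ℤ)
    (hsurj : W.HasSurjectiveModNGaloisRep p) (hK : IsImaginaryQuadratic K)
    (hH : SatisfiesHeegnerHypothesis (W.conductorNorm ℤ) K) {c : K ≃ₐ[ℚ] K} (hc1 : c ≠ 1)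
    (hPT : poitouTate_selmerStructure_duality K) [Module (ZMod p) (Vp W K p)]
    (hodd : Odd (finrank (ZMod p) (SelQP W K p c ∅ true) + finrank (ZMod p) (SelQP W K p c ∅ false))) :
    ∃ n₀ : Finset (AdmQ W K p), n₀.Nonempty ∧ Even n₀.card ∧
      finrank (ZMod p) (SelQP W K p c n₀ true) + finrank (ZMod p) (SelQP W K p c n₀ false) = 1 ∧
      ∀ (μ : Bool) (x : Vp W K p), x ∈ SelQP W K p c n₀ μ → x ≠ 0 →
        ∀ v : HeightOneSpectrum (𝓞 K), ((p : ℕ) : 𝓞 K) ∈ v.asIdeal →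
          x ∉ (W.baseChange K).torsionLocalKer (v.adicCompletion K) ((p ^ 1 : ℕ) : ℤ) := by
  obtain ⟨m, -, hm, hcard⟩ := exists_zero_vertex_above W K p h5 hpN hsurj hK hH hc1 (∅ : Finset (AdmQ W K p))
  rw [Finset.card_empty, zero_add] at hcard
  obtain ⟨q, hqm, htot, hvis⟩ := exists_visibleRaise_of_zero_vertex W K p h5 hpN hsurj hK hH hc1 hPT m hm
  refine ⟨insert q m, Finset.insert_nonempty q m, ?_, htot, hvis⟩
  rw [Finset.card_insert_of_notMem hqm, hcard]
  exact hodd.add_one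

/-- **S-vis, INPUT-FREE** — the same with the Poitou–Tate fact DISCHARGED by the tree theorem
`poitouTate_selmerStructure_duality_holds K` (cell bsd-schneider): no named fact, no `sorry`. BSD is not proved by this; KS′ ∕ KPA′ stay OPEN.
[cite: MazurRubin2004, Prop. 4.5.8] [cite: Howard2006Bipartite, Cor. 2.3.5] [cite: WZhang2014, Prop. 5.4, Lemma 7.3] -/
theorem exists_visibleEvenCoreLevel (h5 : 5 ≤ p) (hpN : p ∣ W.conductorNorm ℤ)
    (hsurj : W.HasSurjectiveModNGaloisRep p) (hK : IsImaginaryQuadratic K)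
    (hH : SatisfiesHeegnerHypothesis (W.conductorNorm ℤ) K) {c : K ≃ₐ[ℚ] K} (hc1 : c ≠ 1)
    [Module (ZMod p) (Vp W K p)]
    (hodd : Odd (finrank (ZMod p) (SelQP W K p c ∅ true) + finrank (ZMod p) (SelQP W K p c ∅ false))) :
    ∃ n₀ : Finset (AdmQ W K p), n₀.Nonempty ∧ Even n₀.card ∧
      finrank (ZMod p) (SelQP W K p c n₀ true) + finrank (ZMod p) (SelQP W K p c n₀ false) = 1 ∧
      ∀ (μ : Bool) (x : Vp W K p), x ∈ SelQP W K p c n₀ μ → x ≠ 0 →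
        ∀ v : HeightOneSpectrum (𝓞 K), ((p : ℕ) : 𝓞 K) ∈ v.asIdeal →
          x ∉ (W.baseChange K).torsionLocalKer (v.adicCompletion K) ((p ^ 1 : ℕ) : ℤ) :=
  exists_visibleEvenCoreLevel_of_poitouTate W K p h5 hpN hsurj hK hH hc1
    (SchneiderFreeAdditiveX3.PoitouTateReduction.poitouTate_selmerStructure_duality_holds (K := K)) hodd

end SVis


end Summit.BirchSwinnertonDyer.BirchSwinnertonDyer.Theorems.AdditiveKoly

end
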